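import Summits.RiemannHypothesis.RiemannHypothesis.Theorems.PfPersistencePerronFakeNodeless
import Summits.RiemannHypothesis.RiemannHypothesis.Theorems.GroundBartaEvenWinsBeyondArchDeflationForms
import HarnessLib

/-!
# PF persistence — PERRON-FAKE (S6), part 6a: POLARISATION of the full windowed form of a real table
# and the TWO LOBES of a real member of the finite-energy class (every real table, every window)

`pub-rhpf` cell, unit `pub-rhpf-prover-perron` (S6; CASE-DAG §6 row PERRON-FAKE; leaves G1.01 / G1.02,
FAKE column; table-side reading of leaves G1.12 / G1.13 / G1.19).  **Mechanism / rigidity campaign;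
no RH claims.**  RH-free, definition-free: Mathlib + proved tree files only.  Toolbox for part 6b
(`PfPersistencePerronFakeNodelessLobeLaw`: the lobe-plane law of a nodal ground state).

Notation: `Q = Q^w_a = tableClosedForm a w` (the FULL closed form of the real table `w` at the window
`a`), the finite-energy window class `coreAdm a`, and for a real `u` the lobes `u⁺ = max(u,0)`,
`u⁻ = max(−u,0)` (as functions `ℝ → ℂ`, the convention of parts 1–5).

* §1 (PROVED) **the class is a real vector space** (`coreAdm.add / .real_smul / .sub`) and **the table
  form polarises on it**: `tableDirichletEnergy_add`, `tableClosedForm_add` (cross term written out with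
  the tree's polar forms `weilPoleForm₂`, `weilIncrement₂` of `OddSectorOddOneSignedWindowsLayerDefs` and
  the bookkeeping of `GroundBartaEvenWinsBeyondArchDeflation{Increments,Forms}`, there done for ζ's table
  only), `tableClosedForm_real_smul`, the bilinearity of the cross term `tableCross_smul_smul`, and the
  DEFINITION-FREE TWO-PARAMETER LAW `tableClosedForm_smul_add_smul`:
  `Q(s f + t h) = s² Q(f) + t² Q(h) + s t (Q(f + h) − Q(f) − Q(h))` for all real `s, t`.
* §2 (PROVED) **the lobes**: `u^± ∈ coreAdm a` whenever `u` is (`coreAdm_posLobe / _negLobe`, via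
  `u^± = (|u| ± u)/2` and the tree's `coreAdm.norm`), `u⁺ + u⁻ = |u|`, `u⁺ − u⁻ = u`, `⟨u⁺, u⁻⟩ = 0`,
  `∫(u⁺)² + ∫(u⁻)² = ∫u²` (`lobeMass_add`), and the mass of a point of the LOBE PLANE
  `‖s u⁺ + t u⁻‖² = s² ∫(u⁺)² + t² ∫(u⁻)²` (`integral_norm_sq_lobes`).

References: E. Bombieri, Rend. Mat. Acc. Lincei (9) 11 (2000) 183–233, Thm 2 (the windowed form and its
Markov decomposition); M. Fukushima, Y. Oshima, M. Takeda, *Dirichlet Forms and Symmetric Markov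
Processes* (2011) §1.1.  The proofs below do not invoke them as facts.
-/

set_option linter.dupNamespace false

noncomputable section

open MeasureTheory Set Filter Complex
open scoped Real Topology ComplexConjugate

namespace Summit.RiemannHypothesis.RiemannHypothesis.Theorems.PfPersistence

open Literature.NumberTheory.LFunctions
open Summit.RiemannHypothesis.RiemannHypothesis.Theorems.OddSector (weilIncrement₂ weilPoleForm₂)
open Summit.RiemannHypothesis.RiemannHypothesis.Theorems.EvenWinsBeyondArch

/-! ## §1 Polarisation of the table form on the finite-energy window class -/

section Polar

variable {a : ℝ} {f h : ℝ → ℂ}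

/-- The class `coreAdm a` is closed under addition. [folklore] -/
theorem coreAdm.add (hf : coreAdm a f) (hh : coreAdm a h) : coreAdm a (f + h) :=
  ⟨hf.1.add hh.1, fun x hx ↦ by simp only [Pi.add_apply, hf.2.1 x hx, hh.2.1 x hx, add_zero],
    dt_finiteEnergy_add hf.1 hh.1 hf.2.2 hh.2.2⟩

/-- The class `coreAdm a` is closed under real scalars. [folklore] -/
theorem coreAdm.real_smul (hf : coreAdm a f) (s : ℝ) : coreAdm a (s • f) := by
  have e : s • f = fun x ↦ (s : ℂ) * f x := funext fun x ↦ dt_smul_apply s f x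
  rw [e]
  exact hf.const_mul (s : ℂ)

/-- The class `coreAdm a` is closed under subtraction. [folklore] -/
theorem coreAdm.sub (hf : coreAdm a f) (hh : coreAdm a h) : coreAdm a (f - h) := by
  have e : f - h = f + (-1 : ℝ) • h := by
    funext x
    simp [sub_eq_add_neg]
  rw [e]
  exact hf.add (hh.real_smul _)

/-- `‖f + h‖² = ‖f‖² + ‖h‖² + 2⟨f, h⟩` on the class. [folklore] -/
theorem integral_norm_sq_add_of_coreAdm (hf : coreAdm a f) (hh : coreAdm a h) :
    ∫ x, ‖(f + h) x‖ ^ 2 =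
      (∫ x, ‖f x‖ ^ 2) + (∫ x, ‖h x‖ ^ 2) + 2 * ∫ x, (f x * conj (h x)).re := by
  have hif : Integrable fun x ↦ ‖f x‖ ^ 2 := (memLp_two_iff_integrable_sq_norm hf.1.1).1 hf.1
  have hih : Integrable fun x ↦ ‖h x‖ ^ 2 := (memLp_two_iff_integrable_sq_norm hh.1.1).1 hh.1
  have hir : Integrable fun x ↦ (f x * conj (h x)).re := dt_integrable_mul_conj_re hf.1 hh.1
  have e : ∀ x, ‖(f + h) x‖ ^ 2 = (‖f x‖ ^ 2 + ‖h x‖ ^ 2) + 2 * (f x * conj (h x)).re :=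
    fun x ↦ by rw [Pi.add_apply, dt_norm_add_sq]
  have hsum : Integrable (fun x ↦ ‖f x‖ ^ 2 + ‖h x‖ ^ 2) := hif.add hih
  have h2 : Integrable (fun x ↦ 2 * (f x * conj (h x)).re) := hir.const_mul 2
  simp_rw [e]
  rw [integral_add hsum h2, integral_add hif hih, integral_const_mul]

/-- **Polarisation of the table energy**: `𝓔^w_a(f + h) = 𝓔^w_a(f) + 𝓔^w_a(h) + 2 𝓔^w_a(f, h)` with
`𝓔^w_a(f, h) = Σ_{log n < 2a} w(n) D_{log n}(f, h) + ∫₀^∞ ρ D_t(f, h) dt`. [folklore] -/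
theorem tableDirichletEnergy_add (w : ℕ → ℝ) (hf : coreAdm a f) (hh : coreAdm a h) :
    tableDirichletEnergy a w (f + h) = tableDirichletEnergy a w f + tableDirichletEnergy a w h +
      2 * ((∑ n ∈ weilPrimeIndex a, w n * weilIncrement₂ f h (Real.log n)) +
        ∫ t in Ioi (0 : ℝ), weilArchDensity t * weilIncrement₂ f h t) := by
  unfold tableDirichletEnergy
  have e : ∀ t, weilArchDensity t * weilIncrement (f + h) t =
      (weilArchDensity t * weilIncrement f t + weilArchDensity t * weilIncrement h t) +
        2 * (weilArchDensity t * weilIncrement₂ f h t) := fun t ↦ by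
    rw [dt_weilIncrement_add hf.1 hh.1]; ring
  have hsum : IntegrableOn (fun t ↦ weilArchDensity t * weilIncrement f t +
      weilArchDensity t * weilIncrement h t) (Ioi 0) := hf.2.2.add hh.2.2
  have h2 : IntegrableOn (fun t ↦ 2 * (weilArchDensity t * weilIncrement₂ f h t)) (Ioi 0) :=
    (dt_integrableOn_weilIncrement₂ hf.1 hh.1 hf.2.2 hh.2.2).const_mul 2
  simp_rw [e, dt_weilIncrement_add hf.1 hh.1]
  rw [integral_add hsum h2, integral_add hf.2.2 hh.2.2, integral_const_mul]
  have es : ∑ n ∈ weilPrimeIndex a, w n *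
      (weilIncrement f (Real.log n) + weilIncrement h (Real.log n) +
        2 * weilIncrement₂ f h (Real.log n)) =
      (∑ n ∈ weilPrimeIndex a, w n * weilIncrement f (Real.log n)) +
      (∑ n ∈ weilPrimeIndex a, w n * weilIncrement h (Real.log n)) +
      2 * ∑ n ∈ weilPrimeIndex a, w n * weilIncrement₂ f h (Real.log n) := by
    rw [Finset.mul_sum, ← Finset.sum_add_distrib, ← Finset.sum_add_distrib]
    exact Finset.sum_congr rfl fun n _ ↦ by ring
  rw [es]
  ring

/-- `𝓔^w_a(s f) = s² 𝓔^w_a(f)` for real `s`. [folklore] -/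
theorem tableDirichletEnergy_real_smul (w : ℕ → ℝ) (s : ℝ) (f : ℝ → ℂ) :
    tableDirichletEnergy a w (s • f) = s ^ 2 * tableDirichletEnergy a w f := by
  have e : s • f = fun x ↦ (s : ℂ) * f x := funext fun x ↦ dt_smul_apply s f x
  rw [e, tableDirichletEnergy_const_mul, Complex.norm_real, Real.norm_eq_abs, sq_abs]

/-- `Q^w_a(s f) = s² Q^w_a(f)` for real `s`. [folklore] -/
theorem tableClosedForm_real_smul (w : ℕ → ℝ) (s : ℝ) (f : ℝ → ℂ) :
    tableClosedForm a w (s • f) = s ^ 2 * tableClosedForm a w f := by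
  unfold tableClosedForm
  rw [dt_weilPoleForm_smul, tableDirichletEnergy_real_smul, dt_integral_norm_sq_smul]
  ring

/-- **Polarisation of the table form**: `Q(f + h) = Q(f) + Q(h) + 2 Q(f, h)` on the class, with the
cross term `Q(f, h) = P(f, h) + 𝓔^w_a(f, h) − M^w_a ⟨f, h⟩` written out. [folklore] -/
theorem tableClosedForm_add (w : ℕ → ℝ) (hf : coreAdm a f) (hh : coreAdm a h) :
    tableClosedForm a w (f + h) = tableClosedForm a w f + tableClosedForm a w h +
      2 * (weilPoleForm₂ f h +
        ((∑ n ∈ weilPrimeIndex a, w n * weilIncrement₂ f h (Real.log n)) +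
          ∫ t in Ioi (0 : ℝ), weilArchDensity t * weilIncrement₂ f h t) -
        tableMarkovConstant a w * ∫ x, (f x * conj (h x)).re) := by
  unfold tableClosedForm
  rw [dt_weilPoleForm_add hf.1 hh.1 hf.2.1 hh.2.1, tableDirichletEnergy_add w hf hh,
    integral_norm_sq_add_of_coreAdm hf hh]
  ring

/-- The cross term is bilinear under real scalars. [folklore] -/
theorem tableCross_smul_smul (w : ℕ → ℝ) (s t : ℝ) (f h : ℝ → ℂ) :
    weilPoleForm₂ (s • f) (t • h) +
        ((∑ n ∈ weilPrimeIndex a, w n * weilIncrement₂ (s • f) (t • h) (Real.log n)) +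
          ∫ τ in Ioi (0 : ℝ), weilArchDensity τ * weilIncrement₂ (s • f) (t • h) τ) -
        tableMarkovConstant a w * ∫ x, ((s • f) x * conj ((t • h) x)).re =
      s * t * (weilPoleForm₂ f h +
        ((∑ n ∈ weilPrimeIndex a, w n * weilIncrement₂ f h (Real.log n)) +
          ∫ τ in Ioi (0 : ℝ), weilArchDensity τ * weilIncrement₂ f h τ) -
        tableMarkovConstant a w * ∫ x, (f x * conj (h x)).re) := by
  have hP : weilPoleForm₂ (s • f) (t • h) = s * t * weilPoleForm₂ f h := by
    rw [dt_weilPoleForm₂_smul_left, dt_weilPoleForm₂_comm, dt_weilPoleForm₂_smul_left,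
      dt_weilPoleForm₂_comm]
    ring
  have hI : ∀ τ, weilIncrement₂ (s • f) (t • h) τ = s * t * weilIncrement₂ f h τ := fun τ ↦ by
    rw [dt_weilIncrement₂_smul_left, dt_weilIncrement₂_comm, dt_weilIncrement₂_smul_left,
      dt_weilIncrement₂_comm]
    ring
  have hN : ∫ x, ((s • f) x * conj ((t • h) x)).re = s * t * ∫ x, (f x * conj (h x)).re := by
    rw [dt_pairing_smul_left, dt_pairing_comm, dt_pairing_smul_left, dt_pairing_comm]
    ring
  have hA : ∫ τ in Ioi (0 : ℝ), weilArchDensity τ * weilIncrement₂ (s • f) (t • h) τ =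
      s * t * ∫ τ in Ioi (0 : ℝ), weilArchDensity τ * weilIncrement₂ f h τ := by
    rw [← integral_const_mul]
    exact integral_congr_ae (Eventually.of_forall fun τ ↦ by simp only [hI]; ring)
  have hS : ∑ n ∈ weilPrimeIndex a, w n * weilIncrement₂ (s • f) (t • h) (Real.log n) =
      s * t * ∑ n ∈ weilPrimeIndex a, w n * weilIncrement₂ f h (Real.log n) := by
    rw [Finset.mul_sum]
    exact Finset.sum_congr rfl fun n _ ↦ by rw [hI]; ring
  rw [hP, hN, hA, hS]
  ring

/-- **The two-parameter law** (definition-free polarisation): on the class,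
`Q(s f + t h) = s² Q(f) + t² Q(h) + s t (Q(f + h) − Q(f) − Q(h))` for all real `s, t`. [folklore] -/
theorem tableClosedForm_smul_add_smul (w : ℕ → ℝ) (hf : coreAdm a f) (hh : coreAdm a h) (s t : ℝ) :
    tableClosedForm a w (s • f + t • h) =
      s ^ 2 * tableClosedForm a w f + t ^ 2 * tableClosedForm a w h +
        s * t * (tableClosedForm a w (f + h) - tableClosedForm a w f - tableClosedForm a w h) := by
  have h1 := tableClosedForm_add w (hf.real_smul s) (hh.real_smul t)
  rw [tableCross_smul_smul, tableClosedForm_real_smul, tableClosedForm_real_smul] at h1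
  have h2 := tableClosedForm_add w hf hh
  rw [h1, h2]
  ring

end Polar

/-! ## §2 The two lobes of a real member of the class -/

section Lobes

variable {a : ℝ} {u : ℝ → ℝ}

/-- `max(r,0) = (|r| + r)/2`. [folklore] -/
private theorem posLobe_eq_half (r : ℝ) : max r 0 = (|r| + r) / 2 := by
  rcases le_total 0 r with h | h
  · rw [max_eq_left h, abs_of_nonneg h]; ring
  · rw [max_eq_right h, abs_of_nonpos h]; ring

/-- `max(−r,0) = (|r| − r)/2`. [folklore] -/
private theorem negLobe_eq_half (r : ℝ) : max (-r) 0 = (|r| - r) / 2 := by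
  rcases le_total 0 r with h | h
  · rw [max_eq_right (neg_nonpos.2 h), abs_of_nonneg h]; ring
  · rw [max_eq_left (neg_nonneg.2 h), abs_of_nonpos h]; ring

/-- `max(r,0) · max(−r,0) = 0`. [folklore] -/
private theorem posLobe_mul_negLobe (r : ℝ) : max r 0 * max (-r) 0 = 0 := by
  rw [posLobe_eq_half, negLobe_eq_half]
  rcases le_total 0 r with h | h
  · rw [abs_of_nonneg h]; ring
  · rw [abs_of_nonpos h]; ring

/-- `u⁺ = (|u| + u)/2` as members of the class. [folklore] -/
theorem posLobe_eq_smul (u : ℝ → ℝ) :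
    (fun x ↦ ((max (u x) 0 : ℝ) : ℂ)) =
      (1 / 2 : ℝ) • ((fun x ↦ ((|u x| : ℝ) : ℂ)) + fun x ↦ ((u x : ℝ) : ℂ)) := by
  funext x
  rw [dt_smul_apply, Pi.add_apply, posLobe_eq_half]
  push_cast
  ring

/-- `u⁻ = (|u| − u)/2` as members of the class. [folklore] -/
theorem negLobe_eq_smul (u : ℝ → ℝ) :
    (fun x ↦ ((max (-u x) 0 : ℝ) : ℂ)) =
      (1 / 2 : ℝ) • ((fun x ↦ ((|u x| : ℝ) : ℂ)) - fun x ↦ ((u x : ℝ) : ℂ)) := by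
  funext x
  rw [dt_smul_apply, Pi.sub_apply, negLobe_eq_half]
  push_cast
  ring

/-- `|u|` (as `ℝ → ℂ`) is a member whenever `u` is. [folklore] -/
theorem coreAdm_absLobe (hU : coreAdm a (fun x ↦ ((u x : ℝ) : ℂ))) :
    coreAdm a (fun x ↦ ((|u x| : ℝ) : ℂ)) := by
  have h := hU.norm
  have e : (fun x ↦ ((‖((u x : ℝ) : ℂ)‖ : ℝ) : ℂ)) = fun x ↦ ((|u x| : ℝ) : ℂ) := by funext x; simp
  rwa [e] at h

/-- The positive lobe `u⁺` of a real member is a member. [folklore] -/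
theorem coreAdm_posLobe (hU : coreAdm a (fun x ↦ ((u x : ℝ) : ℂ))) :
    coreAdm a (fun x ↦ ((max (u x) 0 : ℝ) : ℂ)) := by
  rw [posLobe_eq_smul]
  exact ((coreAdm_absLobe hU).add hU).real_smul _

/-- The negative lobe `u⁻` of a real member is a member. [folklore] -/
theorem coreAdm_negLobe (hU : coreAdm a (fun x ↦ ((u x : ℝ) : ℂ))) :
    coreAdm a (fun x ↦ ((max (-u x) 0 : ℝ) : ℂ)) := by
  rw [negLobe_eq_smul]
  exact ((coreAdm_absLobe hU).sub hU).real_smul _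

/-- `u⁺ + u⁻ = |u|`. [folklore] -/
theorem posLobe_add_negLobe (u : ℝ → ℝ) :
    ((fun x ↦ ((max (u x) 0 : ℝ) : ℂ)) + fun x ↦ ((max (-u x) 0 : ℝ) : ℂ)) =
      fun x ↦ ((|u x| : ℝ) : ℂ) := by
  funext x
  rw [Pi.add_apply, posLobe_eq_half, negLobe_eq_half]
  push_cast
  ring

/-- `1 • u⁺ + (−1) • u⁻ = u`. [folklore] -/
theorem posLobe_sub_negLobe (u : ℝ → ℝ) :
    ((1 : ℝ) • (fun x ↦ ((max (u x) 0 : ℝ) : ℂ)) + (-1 : ℝ) • fun x ↦ ((max (-u x) 0 : ℝ) : ℂ)) =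
      fun x ↦ ((u x : ℝ) : ℂ) := by
  funext x
  rw [Pi.add_apply, dt_smul_apply, dt_smul_apply, posLobe_eq_half, negLobe_eq_half]
  push_cast
  ring

/-- The lobes are `L²`-orthogonal: `⟨u⁺, u⁻⟩ = 0`. [folklore] -/
theorem pairing_posLobe_negLobe (u : ℝ → ℝ) :
    ∫ x, ((((max (u x) 0 : ℝ) : ℂ)) * conj (((max (-u x) 0 : ℝ) : ℂ))).re = 0 := by
  have e : ∀ x, ((((max (u x) 0 : ℝ) : ℂ)) * conj (((max (-u x) 0 : ℝ) : ℂ))).re = 0 := fun x ↦ by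
    rw [Complex.conj_ofReal, ← Complex.ofReal_mul, Complex.ofReal_re, posLobe_mul_negLobe]
  simp_rw [e, integral_zero]

/-- `∫‖u⁺‖² = ∫(u⁺)²` (real form of the lobe mass). [folklore] -/
theorem integral_norm_sq_ofReal (v : ℝ → ℝ) :
    ∫ x, ‖((v x : ℝ) : ℂ)‖ ^ 2 = ∫ x, v x ^ 2 :=
  integral_congr_ae (Eventually.of_forall fun x ↦ by
    simp only [Complex.norm_real, Real.norm_eq_abs, sq_abs])

/-- `∫(u⁺)² < ∞` on the class. [folklore] -/
theorem integrable_posLobe_sq (hU : coreAdm a (fun x ↦ ((u x : ℝ) : ℂ))) :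
    Integrable fun x ↦ max (u x) 0 ^ 2 := by
  have h := (memLp_two_iff_integrable_sq_norm (coreAdm_posLobe hU).1.1).1 (coreAdm_posLobe hU).1
  exact h.congr (Eventually.of_forall fun x ↦ by
    simp only [Complex.norm_real, Real.norm_eq_abs, sq_abs])

/-- `∫(u⁻)² < ∞` on the class. [folklore] -/
theorem integrable_negLobe_sq (hU : coreAdm a (fun x ↦ ((u x : ℝ) : ℂ))) :
    Integrable fun x ↦ max (-u x) 0 ^ 2 := by
  have h := (memLp_two_iff_integrable_sq_norm (coreAdm_negLobe hU).1.1).1 (coreAdm_negLobe hU).1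
  exact h.congr (Eventually.of_forall fun x ↦ by
    simp only [Complex.norm_real, Real.norm_eq_abs, sq_abs])

/-- `max(r,0) − max(−r,0) = r`. [folklore] -/
private theorem posLobe_sub_negLobe_real (r : ℝ) : max r 0 - max (-r) 0 = r := by
  rw [posLobe_eq_half, negLobe_eq_half]; ring

/-- The lobe masses add up: `∫(u⁺)² + ∫(u⁻)² = ∫ u²` on the class. [folklore] -/
theorem lobeMass_add (hU : coreAdm a (fun x ↦ ((u x : ℝ) : ℂ))) :
    (∫ x, max (u x) 0 ^ 2) + ∫ x, max (-u x) 0 ^ 2 = ∫ x, ‖((u x : ℝ) : ℂ)‖ ^ 2 := by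
  rw [← integral_add (integrable_posLobe_sq hU) (integrable_negLobe_sq hU), integral_norm_sq_ofReal]
  refine integral_congr_ae (Eventually.of_forall fun x ↦ ?_)
  show max (u x) 0 ^ 2 + max (-u x) 0 ^ 2 = u x ^ 2
  have h := posLobe_mul_negLobe (u x)
  have h2 := posLobe_sub_negLobe_real (u x)
  calc max (u x) 0 ^ 2 + max (-u x) 0 ^ 2
      = (max (u x) 0 - max (-u x) 0) ^ 2 + 2 * (max (u x) 0 * max (-u x) 0) := by ring
    _ = u x ^ 2 := by rw [h2, h]; ring

/-- **The mass of a point of the lobe plane**: `‖s u⁺ + t u⁻‖² = s² ∫(u⁺)² + t² ∫(u⁻)²`. [folklore] -/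
theorem integral_norm_sq_lobes (hU : coreAdm a (fun x ↦ ((u x : ℝ) : ℂ))) (s t : ℝ) :
    ∫ x, ‖(s • (fun x ↦ ((max (u x) 0 : ℝ) : ℂ)) + t • fun x ↦ ((max (-u x) 0 : ℝ) : ℂ)) x‖ ^ 2 =
      s ^ 2 * (∫ x, max (u x) 0 ^ 2) + t ^ 2 * ∫ x, max (-u x) 0 ^ 2 := by
  rw [integral_norm_sq_add_of_coreAdm ((coreAdm_posLobe hU).real_smul s)
    ((coreAdm_negLobe hU).real_smul t), dt_integral_norm_sq_smul, dt_integral_norm_sq_smul,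
    dt_pairing_smul_left, dt_pairing_comm, dt_pairing_smul_left, dt_pairing_comm,
    pairing_posLobe_negLobe, integral_norm_sq_ofReal, integral_norm_sq_ofReal]
  ring

end Lobes

end Summit.RiemannHypothesis.RiemannHypothesis.Theorems.PfPersistence

end
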